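import Mathlib
import Literature.NumberTheory.LFunctions.Zhang2022.Section17U011MeanValue
import Literature.NumberTheory.LFunctions.Zhang2022.Section17Eq172Extension
import Literature.NumberTheory.LFunctions.Zhang2022.Section17NuStarBound
import HarnessLib

/-!
# Zhang (2022) §17 (17.7), the `Ψ₁ → Ψ` extension on `𝔍(−1)`, head part — moments on the critical
# line: the second moment of the head `Σ_{n≤P²}ϱ*_≤(n)ψ̄(n)n^{−w}`, the fourth moment of
# `B·G·N·N`, and the Hölder core over `Ψ₂`

Topic `Literature/NumberTheory/LFunctions/Zhang2022` (Landau–Siegel audit tree; verdict-neutral).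
Y. Zhang, *Discrete mean estimates and the Landau–Siegel zero*, arXiv:2211.02515v1 (2022)
[Zhang2022LandauSiegel] — **an unrefereed manuscript under adjudication; nothing here asserts or
denies its Theorems 1–2, and no claim about Landau–Siegel zeros is made.** ZHANG-L discharge lane,
WP16 (seat zl-w16-p7, owner of (17.7) `Typed.Section17.Eq17_7`; assembly `Eq177.eq17_7_of_ext`).

§17 p. 97 (tex L4785): "Moving the segment `𝔍(−α)` to `𝔍(−1)` and then extend the sum over `Ψ₁` to
the sum over `Ψ` we obtain (17.7)". The manuscript gives no proof of the extension; the method is the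
one of its twins (7.3)→(7.5) (§7 p. 35) and §15.u009 (p. 80; tree `Typed.Section15A.U009`): on
`𝔍(−1)` write `𝔨₃*(s,ψ)ω(s) = (Σ_n ϱ*_≤(n)ψ̄(n)n^{−(1−s)})·B(s,ψ)G(s,ψ)N(s+β₂,ψ)N(s+β₃,ψ)·ω(s)`
(`ϱ*_≤ = (ν·[≤D⁴]) ∗ κ̄₂`, §17.u017, tree `step17_u017_le_holds`), split the series at `n ≤ ⌊P²⌋`
(HEAD, entire; TAIL, holomorphic on `σ < 0` and moved to `𝔍(−𝓛⁹)` — the sibling seat's file), move the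
head to `𝔍(0)`, and there use Hölder, Lemma 3.3 (ii) and Proposition 2.1. This file supplies the
CRITICAL-LINE MOMENTS of the head (theorems only; no definitions, no named facts):

* `dom_varrhoLe`, `sum_norm_sq_varrhoLe_div_le` — `ϱ*_≤ ≪ 1·((τ₂·𝟙_{≤D⁴}) ∗ τ₂)` (`ν ≤ τ₂` (3.1),
  `|κ̄₂| ≤ τ₂`), so `Σ_{n≤X}|ϱ*_≤(n)|²/n ≤ majorantConst 16 10·(log X)⁴(log D⁴)¹²`;
* `sum_sq_head177_le` — Lemma 3.3 (ii) for the head on `Re w = ½` (conjugating the `ψ̄`-polynomial):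
  `Σ_Ψ|Σ_{n≤⌊P²⌋}ϱ*_≤(n)ψ̄(n)n^{−w}|² ≤ C₃₃P²·majorantConst 16 10·(log⌊P²⌋)⁴(log D⁴)¹²`;
* `sum_pow_four_BGNN_le` — `Σ_Ψ|B·G·N·N(s,ψ)|⁴ ≤ C₃₃P²·K_ι⁴·majorantConst 144 30·(log⌊P²⌋)¹⁶
  (log⌈2T²⌉)⁸⁰(log D⁴)⁴⁸` on `Re s = ½` (its square is the `ψ`-polynomial of `x ∗ x`,
  `x = (bχ) ∗ ν₁*` of length `⌊P⌋`, `Section17U011MeanValue.BGNN_eq_sum_Icc`; `Section7Eq75.sq_dirPoly_eq`;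
  the block `G_x ∗ G_x`, prime values `4 + 4[p≤⌈2T²⌉] + 4[p≤D⁴]`);
* `core177` — with Proposition 2.1 (`Skeleton.prop21_holds`) and `P² ≤ 2𝔓𝓛⁷⁷`: on `Re s = ½`,
  `Σ_{ψ∈Ψ₂}|Σ_{n≤⌊P²⌋}ϱ*_≤(n)ψ̄(n)n^{−(1−s)}|·|BGNN(s,ψ)| ≤ K·𝔓·𝓛⁻¹⁵`
  (`X⁴ ≤ U²V·#Ψ₂ ≤ c𝔓⁴𝓛^{2(48+77)+(352+77)−739} = c𝔓⁴𝓛⁻⁶⁰`, `Typed.Sec14.Eq143.pow_four_le`).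

WHAT THIS IS NOT: the move `𝔍(−1) → 𝔍(0)`, the tail, (17.7) itself, or any claim about Theorems 1–2
of the source.

## References

* Y. Zhang, arXiv:2211.02515v1 (2022), §17 (17.7) p. 97; §7 (7.3)–(7.5) pp. 34–35; §15 p. 80; §2
  Prop. 2.1, (2.9); §3 Lemma 3.3. [cite: Zhang2022LandauSiegel, §17 (17.7) p. 97]
-/

noncomputable section

open Finset Complex Real ComplexConjugate
open Literature.NumberTheory.LFunctions.Zhang2022.Skeleton
open Literature.NumberTheory.LFunctions.Zhang2022.Typed.Section17
open Literature.NumberTheory.LFunctions.Zhang2022.MeanSquareMajorant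
open Literature.NumberTheory.LFunctions.Zhang2022.Typed.Sec14.Eq143
  (card_finsetOf pow_four_le bigP_sq_le floor_bigP_sq_facts)
open scoped LSeries.notation

namespace Literature.NumberTheory.LFunctions.Zhang2022.Eq177

open ArithmeticFunction (pmul_apply)

/-! ## The coefficient `ϱ*_≤ = (ν·[≤D⁴]) ∗ κ̄₂` is block-dominated -/

section Coefficient

variable (c' : ℝ) {D : ℕ} (χ : DirichletCharacter ℂ D)

omit χ in
/-- The cell's `seqConv` is Mathlib's Dirichlet convolution `⍟`. [folklore] -/
private theorem seqConv_eq_convolution' (u v : ℕ → ℂ) : seqConv u v = u ⍟ v := by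
  funext n
  rw [LSeries.convolution_def]
  rfl

/-- `ν·[≤D⁴] ≪ 1·(τ₂·𝟙_{≤D⁴})` ((3.1) `ν ≤ τ₂`). [cite: Zhang2022LandauSiegel, §3 (3.1) p.12] -/
theorem dom_trunc_nu : Dom (trunc (D ^ 4) (nu χ)) 1 ((tau 2).pmul (smoothIndLE (D ^ 4))) := by
  refine dom_pmul_smoothIndLE_of_support zero_le_one (tau_nonneg 2) (fun n _ => ?_) (fun n hn => ?_)
  · rw [one_mul]
    unfold trunc
    split_ifs
    · exact Lemma34.norm_nu_le χ n
    · rw [norm_zero]; exact tau_nonneg 2 n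
  · have : ¬ n ≤ D ^ 4 := not_le.mpr hn
    simp [trunc, this]

omit χ in
/-- `κ̄₂ ≪ 1·τ₂` (`|κ̄₂(m)| = |κ₂(m)| ≤ τ₂(m)`, `κ₂ = n^{−iβ} ∗ μ`).
[cite: Zhang2022LandauSiegel, §17 u016 p.97] -/
theorem dom_kappa2bar : Dom (kappa2bar c' D) 1 (tau 2) := by
  intro n _
  rw [one_mul, kappa2bar, Complex.norm_conj, tau_two_apply]
  exact Phi3Eval.norm_kappa₂_le_card_divisors _ n

/-- **`ϱ*_≤ ≪ 1·((τ₂·𝟙_{≤D⁴}) ∗ τ₂)`**. [cite: Zhang2022LandauSiegel, §17 u017 p.97] -/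
theorem dom_varrhoLe :
    Dom (LSeries.convolution (trunc (D ^ 4) (nu χ)) (kappa2bar c' D)) (1 * 1)
      ((tau 2).pmul (smoothIndLE (D ^ 4)) * tau 2) := by
  have h := dom_seqConv (dom_trunc_nu χ) (dom_kappa2bar c' (D := D))
  rw [seqConv_eq_convolution'] at h
  exact h

/-- `|ϱ*_≤(n)| ≤ τ₄(n)` (pointwise: `τ₂ ∗ τ₂ = τ₄`). [cite: Zhang2022LandauSiegel, §17 u017 p.97] -/
theorem norm_varrhoLe_le_tau (n : ℕ) :
    ‖(LSeries.convolution (trunc (D ^ 4) (nu χ)) (kappa2bar c' D)) n‖ ≤ tau 4 n := by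
  have hu : ∀ m, m ≠ 0 → ‖trunc (D ^ 4) (nu χ) m‖ ≤ 1 * tau 2 m := fun m _ => by
    rw [one_mul]; unfold trunc; split_ifs
    · exact Lemma34.norm_nu_le χ m
    · rw [norm_zero]; exact tau_nonneg 2 m
  have hv : ∀ m, m ≠ 0 → ‖kappa2bar c' D m‖ ≤ 1 * tau 2 m := fun m hm => dom_kappa2bar c' m hm
  have h := norm_seqConv_le_tau zero_le_one hu hv n
  rw [seqConv_eq_convolution', one_mul, one_mul] at h
  exact h

omit χ in
/-- The block `(τ₂·𝟙_{≤z}) ∗ τ₂`: degree `5`, prime values `2[p≤z] + 2`. [folklore] -/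
private theorem isBlock_varrhoBlock (z : ℕ) :
    IsBlock ((tau 2).pmul (smoothIndLE z) * tau 2) 5 ∧
      ∀ p, p.Prime → ((tau 2).pmul (smoothIndLE z) * tau 2) p = 2 * cutInd z p + 2 := by
  have h1 : IsBlock ((tau 2).pmul (smoothIndLE z)) 2 := (isBlock_tau 2).pmul_smoothIndLE z
  refine ⟨by simpa using h1.mul (isBlock_tau 2), fun p hp => ?_⟩
  rw [h1.mul_prime (isBlock_tau 2) hp, pmul_smoothIndLE_prime _ hp, tau_prime 2 hp]
  push_cast
  ring

/-- **`Σ_{n≤X}|ϱ*_≤(n)|²/n ≤ majorantConst 16 10·(log X)⁴·(log D⁴)¹²`** for `X ≥ 2`, `D⁴ ≥ 2`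
(prime values squared `(2+2[p≤D⁴])² ≤ 4 + 12[p≤D⁴]`). [cite: Zhang2022LandauSiegel, §17 p.97; §3 (3.1)] -/
theorem sum_norm_sq_varrhoLe_div_le (hD4 : 2 ≤ D ^ 4) {X : ℕ} (hX : 2 ≤ X) :
    ∑ n ∈ Icc 1 X, ‖(LSeries.convolution (trunc (D ^ 4) (nu χ)) (kappa2bar c' D)) n‖ ^ 2 / n ≤
      majorantConst 16 10 * (Real.log X ^ 4 * Real.log ((D ^ 4 : ℕ) : ℝ) ^ 12) := by
  obtain ⟨hblock, hprime⟩ := isBlock_varrhoBlock (D ^ 4)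
  have hdom := dom_varrhoLe c' χ
  have hGp : ∀ p, p.Prime → ((tau 2).pmul (smoothIndLE (D ^ 4)) * tau 2) p ^ 2 ≤
      ((4 : ℕ) : ℝ) + ((0 : ℕ) : ℝ) * cutInd 2 p + ((12 : ℕ) : ℝ) * cutInd (D ^ 4) p +
        ((0 : ℕ) : ℝ) * (cutInd 0 p * (fun _ : ℕ => (0 : ℝ)) p) + 0 * Real.log p := by
    intro p hp
    rw [hprime p hp]
    rcases cutInd_zero_or_one (D ^ 4) p with h | h <;> rw [h] <;> norm_num
  have key := sum_norm_sq_div_le_of_dom hdom hblock le_rfl (le_refl 2) hD4 hGp hX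
  refine key.trans (le_of_eq ?_)
  rw [scaleBound]
  norm_num

end Coefficient

/-! ## The second moment of the head on `Re w = ½` -/

section HeadMoment

variable (c' : ℝ) {D : ℕ} (χ : DirichletCharacter ℂ D)

/-- **`Σ_{ψ∈Ψ}|Σ_{n≤⌊P²⌋}ϱ*_≤(n)ψ̄(n)n^{−w}|² ≤ C₃₃P²·majorantConst 16 10·(2𝓛⁹)⁴(log D⁴)¹²`** on `Re w = ½`
(`𝓛 ≥ 1`, `D⁴ ≥ 2`): conjugation turns the `ψ̄`-polynomial into a `ψ`-polynomial with coefficients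
`conj ϱ*_≤` at `conj w`, then Lemma 3.3 (ii) (`h33`) and `sum_norm_sq_varrhoLe_div_le`.
[cite: Zhang2022LandauSiegel, §7 (7.5) p.35; §3 Lemma 3.3; §17 (17.7) p.97] -/
theorem sum_sq_head177_le [Fintype (Chr D)] (hℓ : 1 ≤ ell D) (hD4 : 2 ≤ D ^ 4) {C₃₃ : ℝ}
    (h33 : ∀ (s : ℂ) (c : ℕ → ℂ),
      ∑ᶠ x : Chr D, ‖∑ n ∈ Icc 1 ⌊bigP D ^ 2⌋₊, c n * x.ψ (n : ZMod x.p) * (n : ℂ) ^ (-s)‖ ^ 2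
        ≤ C₃₃ * bigP D ^ 2 * ∑ n ∈ Icc 1 ⌊bigP D ^ 2⌋₊, ‖c n‖ ^ 2 * (n : ℝ) ^ (-2 * s.re))
    {w : ℂ} (hw : w.re = 1 / 2) :
    ∑ x : Chr D, ‖∑ n ∈ Icc 1 ⌊bigP D ^ 2⌋₊,
        (LSeries.convolution (trunc (D ^ 4) (nu χ)) (kappa2bar c' D)) n *
          conj (x.ψ (n : ZMod x.p)) * (n : ℂ) ^ (-w)‖ ^ 2 ≤
      max C₃₃ 0 * bigP D ^ 2 *
        (majorantConst 16 10 * ((2 * ell D ^ 9) ^ 4 * Real.log ((D ^ 4 : ℕ) : ℝ) ^ 12)) := by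
  classical
  obtain ⟨hX, hlogX⟩ := floor_bigP_sq_facts hℓ
  set X : ℕ := ⌊bigP D ^ 2⌋₊ with hXdef
  set a : ℕ → ℂ := LSeries.convolution (trunc (D ^ 4) (nu χ)) (kappa2bar c' D) with ha
  have hconj : ∀ x : Chr D,
      ‖∑ n ∈ Icc 1 X, a n * conj (x.ψ (n : ZMod x.p)) * (n : ℂ) ^ (-w)‖ =
        ‖∑ n ∈ Icc 1 X, conj (a n) * x.ψ (n : ZMod x.p) * (n : ℂ) ^ (-conj w)‖ := by
    intro x
    rw [← Complex.norm_conj, map_sum]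
    congr 1
    refine sum_congr rfl fun n _ => ?_
    have hk : conj ((n : ℂ) ^ (-w)) = (n : ℂ) ^ (-conj w) := by
      rw [← map_neg, Complex.cpow_conj _ _ (by rw [Complex.natCast_arg]; exact Real.pi_ne_zero.symm),
        Complex.conj_natCast]
    rw [map_mul, map_mul, Complex.conj_conj, hk]
  have key := h33 (conj w) (fun n => conj (a n))
  rw [finsum_eq_sum_of_fintype] at key
  have hre : -2 * (conj w).re = -1 := by rw [Complex.conj_re, hw]; norm_num
  rw [hre] at key
  simp only [Complex.norm_conj, Real.rpow_neg_one] at key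
  have hmom := sum_norm_sq_varrhoLe_div_le c' χ hD4 hX
  have hM : 0 < majorantConst 16 10 := majorantConst_pos _ _
  have hlog0 : 0 ≤ Real.log (X : ℝ) := Real.log_natCast_nonneg X
  have hlogD0 : 0 ≤ Real.log ((D ^ 4 : ℕ) : ℝ) := Real.log_natCast_nonneg _
  have hmom' : ∑ k ∈ Icc 1 X, ‖a k‖ ^ 2 * (k : ℝ)⁻¹ ≤
      majorantConst 16 10 * ((2 * ell D ^ 9) ^ 4 * Real.log ((D ^ 4 : ℕ) : ℝ) ^ 12) := by
    simp only [← div_eq_mul_inv]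
    refine hmom.trans ?_
    refine mul_le_mul_of_nonneg_left ?_ hM.le
    exact mul_le_mul_of_nonneg_right (pow_le_pow_left₀ hlog0 hlogX 4) (pow_nonneg hlogD0 _)
  calc ∑ x : Chr D, ‖∑ n ∈ Icc 1 X, a n * conj (x.ψ (n : ZMod x.p)) * (n : ℂ) ^ (-w)‖ ^ 2
      = ∑ x : Chr D, ‖∑ n ∈ Icc 1 X, conj (a n) * x.ψ (n : ZMod x.p) * (n : ℂ) ^ (-conj w)‖ ^ 2 := by
        refine sum_congr rfl fun x _ => ?_; rw [hconj x]
    _ ≤ C₃₃ * bigP D ^ 2 * ∑ k ∈ Icc 1 X, ‖a k‖ ^ 2 * (k : ℝ)⁻¹ := key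
    _ ≤ max C₃₃ 0 * bigP D ^ 2 * ∑ k ∈ Icc 1 X, ‖a k‖ ^ 2 * (k : ℝ)⁻¹ := by
        gcongr; exact le_max_left _ _
    _ ≤ max C₃₃ 0 * bigP D ^ 2 *
          (majorantConst 16 10 * ((2 * ell D ^ 9) ^ 4 * Real.log ((D ^ 4 : ℕ) : ℝ) ^ 12)) :=
        mul_le_mul_of_nonneg_left hmom' (mul_nonneg (le_max_right _ _) (sq_nonneg _))

end HeadMoment

/-! ## The fourth moment of `B·G·N·N` on `Re s = ½` -/

section FourthMoment

variable (c' : ℝ) {D : ℕ} [NeZero D] (χ : DirichletCharacter ℂ D)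

omit [NeZero D] χ in
/-- The block of `x = (bχ) ∗ ν₁*` (`Section17U011MeanValue`): `τ₂ ∗ (τ₂·𝟙_{≤z}) ∗ 𝟙_{≤y} ∗ 𝟙_{≤y}`, degree
`7`, prime values `2 + 2[p≤z] + [p≤y] + [p≤y]`. [folklore] -/
private theorem isBlock_xblock' (z y : ℕ) :
    IsBlock (tau 2 * ((tau 2).pmul (smoothIndLE z) * smoothIndLE y * smoothIndLE y)) 7 ∧
      ∀ p, p.Prime → (tau 2 * ((tau 2).pmul (smoothIndLE z) * smoothIndLE y * smoothIndLE y)) p =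
        2 + (2 * cutInd z p + cutInd y p + cutInd y p) := by
  have h1 : IsBlock ((tau 2).pmul (smoothIndLE z)) 2 := (isBlock_tau 2).pmul_smoothIndLE z
  have h2 : IsBlock ((tau 2).pmul (smoothIndLE z) * smoothIndLE y) 3 := by
    simpa using h1.mul (isBlock_smoothIndLE y)
  have h3 : IsBlock ((tau 2).pmul (smoothIndLE z) * smoothIndLE y * smoothIndLE y) 4 := by
    simpa using h2.mul (isBlock_smoothIndLE y)
  refine ⟨by simpa using (isBlock_tau 2).mul h3, fun p hp => ?_⟩
  rw [(isBlock_tau 2).mul_prime h3 hp, h2.mul_prime (isBlock_smoothIndLE y) hp,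
    h1.mul_prime (isBlock_smoothIndLE y) hp, pmul_smoothIndLE_prime _ hp, smoothIndLE_prime hp,
    tau_prime 2 hp]
  push_cast
  ring

/-- **The logarithmic mean square of `x ∗ x`** (`x = (bχ) ∗ ν₁*`, truncated at `n < N`): for `X ≥ 2`,
`Σ_{k≤X}|(x′ ⋆ x′)(k)|²/k ≤ K_ι⁴·majorantConst 144 30·(log X)¹⁶(log⌈2T²⌉)⁸⁰(log D⁴)⁴⁸`
(block `G_x ∗ G_x`, degree `15`, prime values `4 + 4[p≤D⁴] + 4[p≤⌈2T²⌉]`, squared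
`≤ 16 + 80[p≤⌈2T²⌉] + 48[p≤D⁴]`; `𝓛 ≥ 2`, `𝓛 > 0`). [cite: Zhang2022LandauSiegel, §17 (17.7) p.97; §7 (7.5) p.35] -/
theorem sum_norm_sq_xconv_div_le (hD : 2 ≤ Real.log D) (hℓ : 0 < ell D) (hD4 : 2 ≤ D ^ 4)
    (hy : 2 ≤ ⌈2 * bigT D ^ 2⌉₊) (N : ℕ) {X : ℕ} (hX : 2 ≤ X) :
    ∑ k ∈ Icc 1 X, ‖seqConv
        (fun n => if n < N then ((fun n => bcoef D n * χ (n : ZMod D)) ⍟ nuOneStar c' χ) n else 0)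
        (fun n => if n < N then ((fun n => bcoef D n * χ (n : ZMod D)) ⍟ nuOneStar c' χ) n else 0) k‖ ^ 2
          / k ≤
      ((1 + ‖iota2‖) * (‖iota3‖ + ‖iota4‖)) ^ 4 *
        (majorantConst 144 30 * (Real.log X ^ 16 * Real.log ⌈2 * bigT D ^ 2⌉₊ ^ 80 *
          Real.log ((D ^ 4 : ℕ) : ℝ) ^ 48)) := by
  set y : ℕ := ⌈2 * bigT D ^ 2⌉₊ with hy_def
  set K : ℝ := (1 + ‖iota2‖) * (‖iota3‖ + ‖iota4‖) with hK
  have hK0 : 0 ≤ K := Eq172.Kiota_nonneg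
  obtain ⟨hblock, hprime⟩ := isBlock_xblock' (D ^ 4) y
  set G := tau 2 * ((tau 2).pmul (smoothIndLE (D ^ 4)) * smoothIndLE y * smoothIndLE y) with hGdef
  have hdom0 := dom_bcoefChi_conv_nuOneStar c' χ hD hℓ
  rw [show (1 + ‖iota2‖) * (‖iota3‖ + ‖iota4‖) * (1 * 1 * 1) = K by rw [hK]; ring] at hdom0
  have hdom1 := Typed.Section13.dom_trunc_of_dom hdom0 hK0 hblock.nonneg N
  have hdom := dom_seqConv hdom1 hdom1
  have hblock2 : IsBlock (G * G) 15 := by simpa using hblock.mul hblock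
  have hGp : ∀ p, p.Prime → (G * G) p ^ 2 ≤
      ((16 : ℕ) : ℝ) + ((80 : ℕ) : ℝ) * cutInd y p + ((48 : ℕ) : ℝ) * cutInd (D ^ 4) p +
        ((0 : ℕ) : ℝ) * (cutInd 0 p * (fun _ : ℕ => (0 : ℝ)) p) + 0 * Real.log p := by
    intro p hp
    rw [hblock.mul_prime hblock hp, hprime p hp]
    rcases cutInd_zero_or_one y p with h | h <;> rcases cutInd_zero_or_one (D ^ 4) p with h' | h' <;>
      rw [h, h'] <;> norm_num
  have key := sum_norm_sq_div_le_of_dom hdom hblock2 le_rfl hy hD4 hGp hX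
  refine key.trans (le_of_eq ?_)
  rw [scaleBound, show (K * K) ^ 2 = K ^ 4 by ring]
  norm_num

omit [NeZero D] χ in
/-- `⌊P⌋·⌊P⌋ ≤ ⌊P²⌋`. [cite: Zhang2022LandauSiegel, §2 (2.6)] -/
theorem floor_mul_floor_le_floor_sq : ⌊bigP D⌋₊ * ⌊bigP D⌋₊ ≤ ⌊bigP D ^ 2⌋₊ := by
  have hP : 0 ≤ bigP D := (Real.exp_pos _).le
  refine Nat.le_floor ?_
  push_cast
  rw [sq]
  exact mul_le_mul (Nat.floor_le hP) (Nat.floor_le hP) (Nat.cast_nonneg _) hP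

/-- **`Σ_{ψ∈Ψ}|B(s,ψ)G(s,ψ)N(s+β₂,ψ)N(s+β₃,ψ)|⁴ ≤ C₃₃P²·K_ι⁴·majorantConst 144 30·(2𝓛⁹)¹⁶(log⌈2T²⌉)⁸⁰(log D⁴)⁴⁸`**
on `Re s = ½` (`D ≥ 3`, `𝓛 ≥ 4`): `BGNN = Σ_{n≤⌊P⌋}x(n)ψ(n)n^{−s}` (`BGNN_eq_sum_Icc`), its square is the
`ψ`-polynomial of `x′ ⋆ x′` of length `⌊P²⌋` (`Section7Eq75.sq_dirPoly_eq`), Lemma 3.3 (ii), and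
`sum_norm_sq_xconv_div_le`. [cite: Zhang2022LandauSiegel, §7 (7.5) p.35; §17 (17.7) p.97] -/
theorem sum_pow_four_BGNN_le [Fintype (Chr D)] (hD3 : 3 ≤ D) (hℓ4 : 4 ≤ ell D) {C₃₃ : ℝ}
    (h33 : ∀ (s : ℂ) (c : ℕ → ℂ),
      ∑ᶠ x : Chr D, ‖∑ n ∈ Icc 1 ⌊bigP D ^ 2⌋₊, c n * x.ψ (n : ZMod x.p) * (n : ℂ) ^ (-s)‖ ^ 2
        ≤ C₃₃ * bigP D ^ 2 * ∑ n ∈ Icc 1 ⌊bigP D ^ 2⌋₊, ‖c n‖ ^ 2 * (n : ℝ) ^ (-2 * s.re))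
    {s : ℂ} (hs : s.re = 1 / 2) :
    ∑ x : Chr D, ‖Bpoly χ x s * Gpoly χ x s * Nchar D (psiFn x) (s + beta2 c' D) *
        Nchar D (psiFn x) (s + beta3 c' D)‖ ^ 4 ≤
      max C₃₃ 0 * bigP D ^ 2 * (((1 + ‖iota2‖) * (‖iota3‖ + ‖iota4‖)) ^ 4 *
        (majorantConst 144 30 * ((2 * ell D ^ 9) ^ 16 * Real.log ⌈2 * bigT D ^ 2⌉₊ ^ 80 *
          Real.log ((D ^ 4 : ℕ) : ℝ) ^ 48))) := by
  classical
  have hℓ1 : 1 ≤ ell D := by linarith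
  have hℓ0 : 0 < ell D := by linarith
  have hlog2 : 2 ≤ Real.log D := by rw [← ell]; linarith
  obtain ⟨hX, hlogX⟩ := floor_bigP_sq_facts hℓ1
  obtain ⟨-, hy2, hD42⟩ := sizes_two_le hD3 hℓ1
  set X : ℕ := ⌊bigP D ^ 2⌋₊ with hXdef
  set N : ℕ := ⌊bigP D⌋₊ with hNdef
  set xc : ℕ → ℂ := (fun n => bcoef D n * χ (n : ZMod D)) ⍟ nuOneStar c' χ with hxc
  set a' : ℕ → ℂ := fun n => if n < N + 1 then xc n else 0 with ha'
  set b : ℕ → ℂ := seqConv a' a' with hb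
  have hNN : (N + 1 - 1) * (N + 1 - 1) ≤ X := by simpa using floor_mul_floor_le_floor_sq (D := D)
  -- `BGNN` as a polynomial over `range (N+1)` and its square
  have hsq : ∀ x : Chr D,
      (Bpoly χ x s * Gpoly χ x s * Nchar D (psiFn x) (s + beta2 c' D) *
          Nchar D (psiFn x) (s + beta3 c' D)) ^ 2 =
        ∑ k ∈ Icc 1 X, b k * x.ψ (k : ZMod x.p) * (k : ℂ) ^ (-s) := by
    intro x
    have hθ0 : x.ψ ((0 : ℕ) : ZMod x.p) = 0 := by
      rw [Nat.cast_zero, MulChar.map_nonunit _ not_isUnit_zero]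
    have hθ : ∀ m n : ℕ, x.ψ ((m * n : ℕ) : ZMod x.p) = x.ψ (m : ZMod x.p) * x.ψ (n : ZMod x.p) := by
      intro m n; rw [Nat.cast_mul, map_mul]
    have key := Section7Eq75.sq_dirPoly_eq (N + 1) X hNN xc (fun n => x.ψ (n : ZMod x.p)) hθ0 hθ s
    have hrange : ∑ n ∈ Finset.range (N + 1), xc n * x.ψ (n : ZMod x.p) * (n : ℂ) ^ (-s) =
        ∑ n ∈ Icc 1 N, xc n * x.ψ (n : ZMod x.p) * (n : ℂ) ^ (-s) := by
      rw [Finset.range_eq_Ico, Finset.sum_eq_sum_Ico_succ_bot (Nat.succ_pos N), hθ0, mul_zero,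
        zero_mul, zero_add]
      exact sum_congr (by ext n; simp only [Finset.mem_Ico, Finset.mem_Icc]; omega) fun _ _ => rfl
    rw [BGNN_eq_sum_Icc c' χ hD3 hℓ4 x s, ← hrange, key]
  have key := h33 s b
  rw [finsum_eq_sum_of_fintype, hs] at key
  simp only [show -2 * (1 / 2 : ℝ) = -1 by norm_num, Real.rpow_neg_one] at key
  have hmom := sum_norm_sq_xconv_div_le c' χ hlog2 hℓ0 hD42 hy2 (N + 1) hX
  have hM : 0 < majorantConst 144 30 := majorantConst_pos _ _
  have hlog0 : 0 ≤ Real.log (X : ℝ) := Real.log_natCast_nonneg X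
  have hlogy0 : 0 ≤ Real.log (⌈2 * bigT D ^ 2⌉₊ : ℝ) := Real.log_natCast_nonneg _
  have hlogD0 : 0 ≤ Real.log ((D ^ 4 : ℕ) : ℝ) := Real.log_natCast_nonneg _
  have hK0 : 0 ≤ (1 + ‖iota2‖) * (‖iota3‖ + ‖iota4‖) := Eq172.Kiota_nonneg
  have hmom' : ∑ k ∈ Icc 1 X, ‖b k‖ ^ 2 * (k : ℝ)⁻¹ ≤
      ((1 + ‖iota2‖) * (‖iota3‖ + ‖iota4‖)) ^ 4 *
        (majorantConst 144 30 * ((2 * ell D ^ 9) ^ 16 * Real.log ⌈2 * bigT D ^ 2⌉₊ ^ 80 *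
          Real.log ((D ^ 4 : ℕ) : ℝ) ^ 48)) := by
    simp only [← div_eq_mul_inv]
    refine hmom.trans ?_
    refine mul_le_mul_of_nonneg_left ?_ (pow_nonneg hK0 4)
    refine mul_le_mul_of_nonneg_left ?_ hM.le
    exact mul_le_mul_of_nonneg_right (mul_le_mul_of_nonneg_right
      (pow_le_pow_left₀ hlog0 hlogX 16) (pow_nonneg hlogy0 _)) (pow_nonneg hlogD0 _)
  calc ∑ x : Chr D, ‖Bpoly χ x s * Gpoly χ x s * Nchar D (psiFn x) (s + beta2 c' D) *
          Nchar D (psiFn x) (s + beta3 c' D)‖ ^ 4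
      = ∑ x : Chr D, ‖∑ k ∈ Icc 1 X, b k * x.ψ (k : ZMod x.p) * (k : ℂ) ^ (-s)‖ ^ 2 := by
        refine sum_congr rfl fun x _ => ?_
        rw [show (4 : ℕ) = 2 * 2 by norm_num, pow_mul, ← norm_pow, hsq x]
    _ ≤ C₃₃ * bigP D ^ 2 * ∑ k ∈ Icc 1 X, ‖b k‖ ^ 2 * (k : ℝ)⁻¹ := key
    _ ≤ max C₃₃ 0 * bigP D ^ 2 * ∑ k ∈ Icc 1 X, ‖b k‖ ^ 2 * (k : ℝ)⁻¹ := by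
        gcongr; exact le_max_left _ _
    _ ≤ _ := mul_le_mul_of_nonneg_left hmom' (mul_nonneg (le_max_right _ _) (sq_nonneg _))

end FourthMoment

/-! ## The Hölder core over `Ψ₂` on the critical line -/

section Core

/-- `log⌈2T²⌉ ≤ 3𝓛²` (`⌈2T²⌉ ≤ T³` as `T ≥ 3`; `log T = 𝓛^{1.1} ≤ 𝓛²`; `𝓛 ≥ 2`).
[cite: Zhang2022LandauSiegel, §2 (2.6)] -/
theorem log_ceil_two_bigT_sq_le {D : ℕ} (hℓ2 : 2 ≤ ell D) (hy : 2 ≤ ⌈2 * bigT D ^ 2⌉₊) :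
    Real.log ⌈2 * bigT D ^ 2⌉₊ ≤ 3 * ell D ^ 2 := by
  have hℓ1 : 1 ≤ ell D := by linarith
  have hT0 : 0 < bigT D := Real.exp_pos _
  have h11ge : ell D ≤ ell D ^ (1.1 : ℝ) := Real.self_le_rpow_of_one_le hℓ1 (by norm_num)
  have h11 : ell D ^ (1.1 : ℝ) ≤ ell D ^ 2 := by
    have := Real.rpow_le_rpow_of_exponent_le hℓ1 (by norm_num : (1.1 : ℝ) ≤ 2)
    rwa [Real.rpow_two] at this
  have hT3 : (3 : ℝ) ≤ bigT D := by
    have hl3 : Real.log 3 < 2 := by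
      have := Real.log_lt_sub_one_of_pos (by norm_num : (0:ℝ) < 3) (by norm_num)
      linarith
    have h3 : Real.log 3 ≤ ell D ^ (1.1 : ℝ) := by linarith
    calc (3 : ℝ) = Real.exp (Real.log 3) := (Real.exp_log (by norm_num)).symm
      _ ≤ bigT D := by rw [bigT]; exact Real.exp_le_exp.mpr h3
  have hy0 : (0 : ℝ) < ⌈2 * bigT D ^ 2⌉₊ := by
    have : (2 : ℝ) ≤ ⌈2 * bigT D ^ 2⌉₊ := by exact_mod_cast hy
    linarith
  have hyle : (⌈2 * bigT D ^ 2⌉₊ : ℝ) ≤ bigT D ^ 3 := by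
    have h1 : (⌈2 * bigT D ^ 2⌉₊ : ℝ) < 2 * bigT D ^ 2 + 1 := Nat.ceil_lt_add_one (by positivity)
    have h2 : 2 * bigT D ^ 2 + 1 ≤ bigT D ^ 3 := by nlinarith
    linarith
  calc Real.log ⌈2 * bigT D ^ 2⌉₊ ≤ Real.log (bigT D ^ 3) := Real.log_le_log hy0 hyle
    _ = 3 * ell D ^ (1.1 : ℝ) := by rw [Real.log_pow, bigT, Real.log_exp]; push_cast; ring
    _ ≤ 3 * ell D ^ 2 := by linarith

/-- `log D⁴ = 4𝓛`. [cite: Zhang2022LandauSiegel, §2 p. 4] -/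
theorem log_pow_four_eq (D : ℕ) : Real.log ((D ^ 4 : ℕ) : ℝ) = 4 * ell D := by
  rw [ell, show ((D ^ 4 : ℕ) : ℝ) = (D : ℝ) ^ 4 by push_cast; ring, Real.log_pow]
  push_cast; ring

/-- **The (17.7)-instance of the display proving (7.5)** (Proposition 2.1 and Lemma 3.3 (ii) are
theorems of the tree): there is `K` such that for all large `D`, every real primitive `χ (mod D)` with
(A), and every `s` with `Re s = ½`:
`Σ_{ψ∈Ψ₂} |Σ_{n≤⌊P²⌋}ϱ*_≤(n)ψ̄(n)n^{−(1−s)}|·|B(s,ψ)G(s,ψ)N(s+β₂,ψ)N(s+β₃,ψ)| ≤ K·𝔓·𝓛⁻¹⁵`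
(`X⁴ ≤ U²V·#Ψ₂`, `U ≤ c_UP²𝓛⁴⁸`, `V ≤ c_VP²𝓛³⁵²`, `#Ψ₂ ≤ C₂₁𝔓𝓛⁻⁷³⁹`, `P² ≤ 2𝔓𝓛⁷⁷` ⇒ `X⁴ ≤ c𝔓⁴𝓛⁻⁶⁰`).
[cite: Zhang2022LandauSiegel, §17 (17.7) p.97; §7 (7.5) p.35] -/
theorem core177 (c' : ℝ) :
    ∃ K : ℝ, ForAllLarge fun D _ χ => AssumptionA D χ → ∀ s : ℂ, s.re = 1 / 2 →
      ∑ x ∈ finsetOf (PsiTwo χ),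
        ‖∑ n ∈ Icc 1 ⌊bigP D ^ 2⌋₊,
            (LSeries.convolution (trunc (D ^ 4) (nu χ)) (kappa2bar c' D)) n *
              conj (x.ψ (n : ZMod x.p)) * (n : ℂ) ^ (-(1 - s))‖ *
          ‖Bpoly χ x s * Gpoly χ x s * Nchar D (psiFn x) (s + beta2 c' D) *
            Nchar D (psiFn x) (s + beta3 c' D)‖ ≤ K * frakP D * (ell D ^ 15)⁻¹ := by
  obtain ⟨C₂₁, D₁, hD₁⟩ := prop21_holds
  obtain ⟨C₃₃, h33⟩ := lemma33b_holds
  set Kι : ℝ := (1 + ‖iota2‖) * (‖iota3‖ + ‖iota4‖) with hKι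
  have hKι0 : 0 ≤ Kι := Eq172.Kiota_nonneg
  set cU : ℝ := max C₃₃ 0 * (majorantConst 16 10 * (2 ^ 4 * 4 ^ 12)) with hcU
  set cV : ℝ := max C₃₃ 0 * (Kι ^ 4 * (majorantConst 144 30 * (2 ^ 16 * 3 ^ 80 * 4 ^ 48))) with hcV
  set c : ℝ := 8 * cU ^ 2 * cV * max C₂₁ 0 with hc
  have hM16 := majorantConst_pos 16 10; have hM144 := majorantConst_pos 144 30
  have hcU0 : 0 ≤ cU := by positivity
  have hcV0 : 0 ≤ cV := by positivity
  have hc0 : 0 ≤ c := by positivity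
  refine ⟨1 + c, ?_⟩
  obtain ⟨D₂, hD₂⟩ := bigP_sq_le
  obtain ⟨D₃, hD₃⟩ := Section7Eq75.exists_nat_le_ell 4
  refine ⟨max (max D₁ D₂) (max D₃ 3), fun D _ χ hD hq hp hA s hs => ?_⟩
  simp only [max_le_iff] at hD
  obtain ⟨⟨hD₁', hD₂'⟩, hD₃', hD3⟩ := hD
  have hℓ4 : 4 ≤ ell D := hD₃ D hD₃'
  have hℓ : 1 ≤ ell D := by linarith
  have hℓ0 : 0 < ell D := by linarith
  haveI : Fintype (Chr D) := Fintype.ofFinite _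
  obtain ⟨hP2, hy2, hD42⟩ := sizes_two_le hD3 hℓ
  set ℓ : ℝ := ell D with hℓdef; set Pf : ℝ := frakP D with hPf
  have hPf0 : 0 ≤ Pf := by
    rw [hPf, frakP_eq_sum_primeWindow]; exact sum_nonneg fun p _ => Nat.cast_nonneg p
  have hw : (1 - s).re = 1 / 2 := by simp [hs]; norm_num
  have hU := sum_sq_head177_le c' χ hℓ hD42 (h33 D) hw
  have hV := sum_pow_four_BGNN_le c' χ hD3 hℓ4 (h33 D) hs
  -- the logarithms as powers of `𝓛`
  have hlogy := log_ceil_two_bigT_sq_le (D := D) (by linarith) hy2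
  have hlogy0 : 0 ≤ Real.log (⌈2 * bigT D ^ 2⌉₊ : ℝ) := Real.log_natCast_nonneg _
  rw [log_pow_four_eq D] at hU hV
  have hU' : ∑ x : Chr D, ‖∑ n ∈ Icc 1 ⌊bigP D ^ 2⌋₊,
      (LSeries.convolution (trunc (D ^ 4) (nu χ)) (kappa2bar c' D)) n *
        conj (x.ψ (n : ZMod x.p)) * (n : ℂ) ^ (-(1 - s))‖ ^ 2 ≤ cU * bigP D ^ 2 * ℓ ^ 48 := by
    refine hU.trans (le_of_eq ?_); rw [hcU]; ring
  have hV' : ∑ x : Chr D, ‖Bpoly χ x s * Gpoly χ x s * Nchar D (psiFn x) (s + beta2 c' D) *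
      Nchar D (psiFn x) (s + beta3 c' D)‖ ^ 4 ≤ cV * bigP D ^ 2 * ℓ ^ 352 := by
    refine hV.trans ?_
    have e80 : Real.log (⌈2 * bigT D ^ 2⌉₊ : ℝ) ^ 80 ≤ (3 * ℓ ^ 2) ^ 80 := pow_le_pow_left₀ hlogy0 hlogy 80
    have hP20 : 0 ≤ max C₃₃ 0 * bigP D ^ 2 := mul_nonneg (le_max_right _ _) (sq_nonneg _)
    calc max C₃₃ 0 * bigP D ^ 2 * (Kι ^ 4 * (majorantConst 144 30 *
          ((2 * ℓ ^ 9) ^ 16 * Real.log (⌈2 * bigT D ^ 2⌉₊ : ℝ) ^ 80 * (4 * ℓ) ^ 48)))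
        ≤ max C₃₃ 0 * bigP D ^ 2 * (Kι ^ 4 * (majorantConst 144 30 *
          ((2 * ℓ ^ 9) ^ 16 * (3 * ℓ ^ 2) ^ 80 * (4 * ℓ) ^ 48))) := by gcongr
      _ = cV * bigP D ^ 2 * ℓ ^ 352 := by rw [hcV]; ring
  have hS : ((finsetOf (PsiTwo χ)).card : ℝ) ≤ max C₂₁ 0 * Pf * (ℓ ^ 739)⁻¹ := by
    rw [card_finsetOf (Set.toFinite _)]
    refine (hD₁ D χ hD₁' hq hp hA).trans ?_
    exact mul_le_mul_of_nonneg_right (mul_le_mul_of_nonneg_right (le_max_left _ _) hPf0)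
      (inv_nonneg.mpr (pow_nonneg hℓ0.le _))
  have hP2 : bigP D ^ 2 ≤ 2 * Pf * ℓ ^ 77 := hD₂ D hD₂'
  have hP20 : 0 ≤ bigP D ^ 2 := sq_nonneg _
  have hX4 := pow_four_le (finsetOf (PsiTwo χ)) Finset.univ (Finset.subset_univ _)
    (fun x : Chr D => ‖∑ n ∈ Icc 1 ⌊bigP D ^ 2⌋₊,
      (LSeries.convolution (trunc (D ^ 4) (nu χ)) (kappa2bar c' D)) n *
        conj (x.ψ (n : ZMod x.p)) * (n : ℂ) ^ (-(1 - s))‖)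
    (fun x : Chr D => ‖Bpoly χ x s * Gpoly χ x s * Nchar D (psiFn x) (s + beta2 c' D) *
      Nchar D (psiFn x) (s + beta3 c' D)‖)
    (fun _ => norm_nonneg _) (fun _ => norm_nonneg _)
  have hUn : 0 ≤ ∑ x : Chr D, ‖∑ n ∈ Icc 1 ⌊bigP D ^ 2⌋₊,
      (LSeries.convolution (trunc (D ^ 4) (nu χ)) (kappa2bar c' D)) n *
        conj (x.ψ (n : ZMod x.p)) * (n : ℂ) ^ (-(1 - s))‖ ^ 2 := sum_nonneg fun x _ => sq_nonneg _
  have hVn : 0 ≤ ∑ x : Chr D, ‖Bpoly χ x s * Gpoly χ x s * Nchar D (psiFn x) (s + beta2 c' D) *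
      Nchar D (psiFn x) (s + beta3 c' D)‖ ^ 4 := sum_nonneg fun x _ => by positivity
  have h1 := hX4.trans (mul_le_mul (pow_le_pow_left₀ hUn hU' 2) (mul_le_mul hV' hS (Nat.cast_nonneg _)
    (hVn.trans hV')) (mul_nonneg hVn (Nat.cast_nonneg _)) (sq_nonneg _))
  have h2 : (cU * bigP D ^ 2 * ℓ ^ 48) ^ 2 *
      ((cV * bigP D ^ 2 * ℓ ^ 352) * (max C₂₁ 0 * Pf * (ℓ ^ 739)⁻¹)) ≤
      (cU * (2 * Pf * ℓ ^ 77) * ℓ ^ 48) ^ 2 *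
        ((cV * (2 * Pf * ℓ ^ 77) * ℓ ^ 352) * (max C₂₁ 0 * Pf * (ℓ ^ 739)⁻¹)) := by
    have : 0 ≤ (ℓ ^ 739)⁻¹ := inv_nonneg.mpr (pow_nonneg hℓ0.le _)
    gcongr
  have h3 : (cU * (2 * Pf * ℓ ^ 77) * ℓ ^ 48) ^ 2 *
      ((cV * (2 * Pf * ℓ ^ 77) * ℓ ^ 352) * (max C₂₁ 0 * Pf * (ℓ ^ 739)⁻¹)) =
      c * Pf ^ 4 * (ℓ ^ 60)⁻¹ := by
    rw [hc]; field_simp; ring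
  have h4 : c * Pf ^ 4 * (ℓ ^ 60)⁻¹ ≤ ((1 + c) * Pf * (ℓ ^ 15)⁻¹) ^ 4 := by
    have hK : c ≤ (1 + c) ^ 4 :=
      (le_add_of_nonneg_left zero_le_one).trans (le_self_pow₀ (by linarith) (by norm_num))
    calc c * Pf ^ 4 * (ℓ ^ 60)⁻¹ ≤ (1 + c) ^ 4 * Pf ^ 4 * (ℓ ^ 60)⁻¹ := by gcongr
      _ = ((1 + c) * Pf * (ℓ ^ 15)⁻¹) ^ 4 := by rw [mul_pow, mul_pow, inv_pow, ← pow_mul]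
  have hK0 : 0 ≤ (1 + c) * Pf * (ℓ ^ 15)⁻¹ := by positivity
  exact le_of_pow_le_pow_left₀ (by norm_num) hK0 (h1.trans (h2.trans (h3.le.trans h4)))

end Core

end Literature.NumberTheory.LFunctions.Zhang2022.Eq177
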